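import Mathlib
import Literature.Probability.LatticeModels.ProdBernoulliIndependence
import Literature.Probability.LatticeModels.ProdBernoulliSuperposition
import Literature.Probability.Percolation.SharpnessDCTProofs
import Literature.Probability.Percolation.PercolationProofs
import HarnessLib

/-!
# Crux `PercNearOneGluing.NearOneGluing` (stmt-CriticalPhenomena-4574), line `live-seal-vanishing-sprinkle` — stub `stub_sprinkleCoupling`

Helper file for the crux (lead prover-line-stmt-CriticalPhenomena-4574-a1-0, wave 1): proves
exactly the registered stub signature `stub_sprinkleCoupling` (the sprinkling step of
"Conjecture 3 after a vanishing sprinkle") of the line skeleton; lands with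
`--supports stmt-CriticalPhenomena-4574`.

## Content: the sprinkle coupling

Notation: `μ_w = prodBernoulli w` on `Set (Sym2 (Fin n))` (a pair `e` is open iff `e ∈ ω`);
relay set `A`, source `o`, target `b`; `P ω` the relay-free pocket of `o`
(`v ∈ P ω ↔ o ↔ v inside (↑A)ᶜ`); `L T ω` the live boundary pairs of `T` towards `b`
(`s(x,y)`, `x ∈ T`, `y ∉ T`, `y ↔ b inside (↑T)ᶜ`); `κ(ω) = ∏_{e ∈ L (P ω) ω} (1 - w e)`;
bad `= {o ↮ b} ∩ {o ↔ A}`.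

STATEMENT (`stub_sprinkleCoupling`). If `1 - w' e = (1 - w e)^{1+t}` (`t > 0`) for every pair,
then `μ_{w'}(o ↮ b) ≤ μ_w(o ↮ A) + ∫_bad κ^t dμ_w`.

PROOF. Realise `μ_{w'}` as the law of the union of two independent layers: one product measure
`prodBernoulli Q` on `Set (Sym2 (Fin n) × Fin 2)` with `Q (e,0) = w e` and
`1 - Q (e,1) = (1 - w e)^t`, so that the superposed parameter `1 - (1 - w e)(1 - w e)^t` is `w' e`
(`prodBernoulli_real_preimage_superpose`). The walk lemma `sprinkleCoupling_cover`:
`{union ∈ o ↮ b} ⊆ {layer₀ ∈ o ↮ A} ∪ {layer₀ bad ∧ layer₁ misses L (P layer₀) layer₀}` — a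
layer-`1` pair `s(x,y)` of the live seal of the pocket of layer `0` joins `o ↔ x` (inside the
pocket) to `y ↔ b` (off the pocket) in the union. The fibre lemma
`sprinkleCoupling_real_layer_fibre`: partitioning by the value `ω₀` of layer `0` (finite space),
`{layer₀ = ω₀}` (determined by the layer-`0` coordinates) is independent of
`{layer₁ misses F ω₀}` (layer-`1` coordinates; probability `∏_{e ∈ F ω₀} (1 - Q (e,1))`), so
`μ_Q{layer₀ bad ∧ layer₁ misses F layer₀} = ∫ 1_bad(ω) ∏_{e ∈ F ω} (1 - Q (e,1)) dμ_w(ω)`, which is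
`∫_bad κ^t dμ_w` by `∏ (1 - w e)^t = (∏ (1 - w e))^t`. The layer-`0` term is `μ_w(o ↮ A)`
(`prodBernoulli_map_layer`), and a union bound concludes.
-/

namespace Summit.CriticalPhenomena.PercolationContinuityZ3.Theorems

open scoped BigOperators Classical
open MeasureTheory Set
open Literature.Probability.LatticeModels (prodBernoulli prodBernoulli_map_layer
  prodBernoulli_real_preimage_superpose prodBernoulli_real_forall_notMem
  prodBernoulli_real_inter_of_determinedBy_disjoint coe_symm_symm_mul_symm)
open Literature.Probability.Percolation (openConn openConnIn openGraph openGraph_adj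
  openGraph_mono isUpperSet_openConn DeterminedBy determinedBy_iff)
open Literature.Probability.Percolation.DCT16 (reachable_of_pathIn pathIn_of_mem_openConnIn)

/-! ### Two-layer bookkeeping (any index type) -/

section Layers

variable {ι : Type*}

/-- Under the two-layer product measure `prodBernoulli Q` on `Set (ι × Fin 2)`, an event about
layer `0` (the configuration `{i | (i,0) ∈ ξ}`) has its `prodBernoulli (i ↦ Q (i,0))`-probability
(the law of one layer, `prodBernoulli_map_layer`). -/
theorem sprinkleCoupling_real_preimage_layer (Q : ι × Fin 2 → unitInterval) {S : Set (Set ι)}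
    (hS : MeasurableSet S) :
    (prodBernoulli Q).real
        ((fun ξ : Set (ι × Fin 2) => {i | (i, (0 : Fin 2)) ∈ ξ}) ⁻¹' S) =
      (prodBernoulli fun i => Q (i, 0)).real S := by
  have hmeas : Measurable (fun ξ : Set (ι × Fin 2) => {i | (i, (0 : Fin 2)) ∈ ξ}) :=
    measurable_set_iff.2 fun i => measurable_set_mem (i, (0 : Fin 2))
  rw [← prodBernoulli_map_layer Q 0, map_measureReal_apply hmeas hS]

/-- The fibre `{layer₀ = ω₀}` is determined by the layer-`0` coordinates `univ ×ˢ {0}`. -/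
theorem sprinkleCoupling_determinedBy_layer [Fintype ι] (ω₀ : Set ι) :
    DeterminedBy {ξ : Set (ι × Fin 2) | {i | (i, (0 : Fin 2)) ∈ ξ} = ω₀}
      (↑((Finset.univ : Finset ι) ×ˢ ({0} : Finset (Fin 2))) : Set (ι × Fin 2)) := by
  rw [determinedBy_iff]
  intro ξ ξ' h
  have key : ∀ i, (i, (0 : Fin 2)) ∈ ξ ↔ (i, (0 : Fin 2)) ∈ ξ' := by
    intro i
    have hi : (i, (0 : Fin 2)) ∈
        (↑((Finset.univ : Finset ι) ×ˢ ({0} : Finset (Fin 2))) : Set (ι × Fin 2)) :=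
      Finset.mem_coe.2 (Finset.mem_product.2 ⟨Finset.mem_univ _, Finset.mem_singleton_self _⟩)
    have := Set.ext_iff.1 h (i, (0 : Fin 2))
    simp only [mem_inter_iff, hi, and_true] at this
    exact this
  simp only [mem_setOf_eq]
  rw [show ({i | (i, (0 : Fin 2)) ∈ ξ} : Set ι) = {i | (i, (0 : Fin 2)) ∈ ξ'} from
    Set.ext fun i => key i]

/-- The event "layer `1` misses every coordinate of `G`" (`G` a finite set of layer-`1`
coordinates) is determined by the layer-`1` coordinates `univ ×ˢ {1}`. -/
theorem sprinkleCoupling_determinedBy_miss [Fintype ι] (G : Finset (ι × Fin 2))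
    (hG : ∀ k ∈ G, k.2 = 1) :
    DeterminedBy {ξ : Set (ι × Fin 2) | ∀ k ∈ G, k ∉ ξ}
      (↑((Finset.univ : Finset ι) ×ˢ ({1} : Finset (Fin 2))) : Set (ι × Fin 2)) := by
  rw [determinedBy_iff]
  intro ξ ξ' h
  simp only [mem_setOf_eq]
  refine forall₂_congr fun k hk => not_congr ?_
  have hk1 : k ∈ (↑((Finset.univ : Finset ι) ×ˢ ({1} : Finset (Fin 2))) : Set (ι × Fin 2)) :=
    Finset.mem_coe.2 (Finset.mem_product.2 ⟨Finset.mem_univ _, Finset.mem_singleton.2 (hG k hk)⟩)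
  have := Set.ext_iff.1 h k
  simp only [mem_inter_iff, hk1, and_true] at this
  exact this

/-- **Fibrewise independence of the two layers** (finite index type). For an event `B` about
layer `0` and a layer-`0`-dependent finite set of coordinates `F`, the probability that layer `0`
lies in `B` while layer `1` misses every coordinate of `F (layer₀)` is
`∫ 1_B(ω) ∏_{e ∈ F ω} (1 - Q (e,1)) d(prodBernoulli (Q (·,0)))(ω)`: partition by the value `ω₀`
of layer `0`; on each fibre the two constraints are determined by disjoint sets of coordinates,
hence independent (`prodBernoulli_real_inter_of_determinedBy_disjoint`), with probabilities
`μ₀{ω₀}` (`prodBernoulli_map_layer`) and `∏_{e ∈ F ω₀} (1 - Q (e,1))`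
(`prodBernoulli_real_forall_notMem`); the integral over the finite space is the matching sum. -/
theorem sprinkleCoupling_real_layer_fibre [Fintype ι] (Q : ι × Fin 2 → unitInterval)
    (B : Set (Set ι)) (F : Set ι → Finset ι) :
    (prodBernoulli Q).real {ξ : Set (ι × Fin 2) | {i | (i, (0 : Fin 2)) ∈ ξ} ∈ B ∧
        ∀ e ∈ F {i | (i, (0 : Fin 2)) ∈ ξ}, (e, (1 : Fin 2)) ∉ ξ} =
      ∫ ω, B.indicator (fun ω => ∏ e ∈ F ω, (1 - (Q (e, 1) : ℝ))) ω
        ∂(prodBernoulli fun i => Q (i, 0)) := by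
  -- partition by the value `ω₀` of layer `0`
  have hE : {ξ : Set (ι × Fin 2) | {i | (i, (0 : Fin 2)) ∈ ξ} ∈ B ∧
      ∀ e ∈ F {i | (i, (0 : Fin 2)) ∈ ξ}, (e, (1 : Fin 2)) ∉ ξ} =
      ⋃ ω₀ ∈ (Finset.univ : Finset (Set ι)), {ξ : Set (ι × Fin 2) |
        {i | (i, (0 : Fin 2)) ∈ ξ} = ω₀ ∧ ω₀ ∈ B ∧ ∀ e ∈ F ω₀, (e, (1 : Fin 2)) ∉ ξ} := by
    ext ξ
    simp only [Finset.mem_univ, iUnion_true, mem_iUnion, mem_setOf_eq]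
    exact ⟨fun h => ⟨_, rfl, h⟩, fun ⟨ω₀, h0, h⟩ => by subst h0; exact h⟩
  have hdisj : Set.PairwiseDisjoint (↑(Finset.univ : Finset (Set ι)))
      (fun ω₀ => {ξ : Set (ι × Fin 2) |
        {i | (i, (0 : Fin 2)) ∈ ξ} = ω₀ ∧ ω₀ ∈ B ∧ ∀ e ∈ F ω₀, (e, (1 : Fin 2)) ∉ ξ}) :=
    fun x _ y _ hxy => Set.disjoint_left.2 fun ξ hx hy => hxy (hx.1.symm.trans hy.1)
  rw [hE, measureReal_biUnion_finset hdisj (fun _ _ => MeasurableSet.of_discrete),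
    integral_fintype Integrable.of_finite]
  refine Finset.sum_congr rfl fun ω₀ _ => ?_
  by_cases hB : ω₀ ∈ B
  · -- a bad fibre: independence of `{layer₀ = ω₀}` and `{layer₁ misses F ω₀}`
    rw [indicator_of_mem hB, smul_eq_mul]
    have hset : {ξ : Set (ι × Fin 2) |
        {i | (i, (0 : Fin 2)) ∈ ξ} = ω₀ ∧ ω₀ ∈ B ∧ ∀ e ∈ F ω₀, (e, (1 : Fin 2)) ∉ ξ} =
        {ξ | {i | (i, (0 : Fin 2)) ∈ ξ} = ω₀} ∩
          {ξ | ∀ k ∈ (F ω₀).image (fun e => (e, (1 : Fin 2))), k ∉ ξ} := by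
      ext ξ
      simp only [mem_setOf_eq, mem_inter_iff]
      constructor
      · rintro ⟨h0, -, hF⟩
        refine ⟨h0, fun k hk => ?_⟩
        obtain ⟨e, he, rfl⟩ := Finset.mem_image.1 hk
        exact hF e he
      · rintro ⟨h0, hF⟩
        exact ⟨h0, hB, fun e he => hF _ (Finset.mem_image_of_mem _ he)⟩
    have hG : ∀ k ∈ (F ω₀).image (fun e => (e, (1 : Fin 2))), k.2 = 1 := by
      intro k hk
      obtain ⟨e, -, rfl⟩ := Finset.mem_image.1 hk
      rfl
    have hdj : Disjoint ((Finset.univ : Finset ι) ×ˢ ({0} : Finset (Fin 2)))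
        ((Finset.univ : Finset ι) ×ˢ ({1} : Finset (Fin 2))) :=
      Finset.disjoint_product.2 (Or.inr (Finset.disjoint_singleton.2 (by decide)))
    rw [hset, prodBernoulli_real_inter_of_determinedBy_disjoint Q hdj
      (sprinkleCoupling_determinedBy_layer ω₀) (sprinkleCoupling_determinedBy_miss _ hG)
      MeasurableSet.of_discrete MeasurableSet.of_discrete]
    congr 1
    · exact sprinkleCoupling_real_preimage_layer Q (measurableSet_singleton ω₀)
    · rw [prodBernoulli_real_forall_notMem,
        Finset.prod_image (Prod.mk_left_injective (1 : Fin 2)).injOn]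
  · -- a good fibre is empty
    have hset : {ξ : Set (ι × Fin 2) |
        {i | (i, (0 : Fin 2)) ∈ ξ} = ω₀ ∧ ω₀ ∈ B ∧ ∀ e ∈ F ω₀, (e, (1 : Fin 2)) ∉ ξ} = ∅ := by
      ext ξ
      simp [hB]
    rw [hset, measureReal_empty, indicator_of_notMem hB, smul_zero]

end Layers

/-! ### The walk lemma -/

/-- **The walk lemma.** If the union of the two layers does not join `o` to `b`, then either
layer `0` does not join `o` to `A`, or layer `0` is bad (`o ↮ b`, `o ↔ A`) and layer `1` contains
no live boundary pair of the pocket of layer `0`: such a pair `s(x,y)` (`x` in the pocket, `y`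
joined to `b` off the pocket, in layer `0`) would join `o ↔ x – y ↔ b` in the union. -/
theorem sprinkleCoupling_cover {n : ℕ} (A : Finset (Fin n)) (o b : Fin n)
    (P : Set (Sym2 (Fin n)) → Finset (Fin n))
    (hP : ∀ ω v, v ∈ P ω ↔ ω ∈ openConnIn ((↑A : Set (Fin n))ᶜ) o v)
    (L : Finset (Fin n) → Set (Sym2 (Fin n)) → Finset (Sym2 (Fin n)))
    (hL : ∀ T ω e, e ∈ L T ω ↔
      ∃ x ∈ T, ∃ y ∉ T, e = s(x, y) ∧ ω ∈ openConnIn ((↑T : Set (Fin n))ᶜ) y b) :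
    (fun ξ : Set (Sym2 (Fin n) × Fin 2) => {i | (i, (0 : Fin 2)) ∈ ξ ∨ (i, (1 : Fin 2)) ∈ ξ}) ⁻¹'
        (openConn o b)ᶜ ⊆
      (fun ξ : Set (Sym2 (Fin n) × Fin 2) => {i | (i, (0 : Fin 2)) ∈ ξ}) ⁻¹'
          (⋃ a ∈ A, openConn o a)ᶜ ∪
        {ξ | {i | (i, (0 : Fin 2)) ∈ ξ} ∈
            {ω | ω ∉ openConn o b ∧ ∃ a ∈ A, ω ∈ openConn o a} ∧
          ∀ e ∈ L (P {i | (i, (0 : Fin 2)) ∈ ξ}) {i | (i, (0 : Fin 2)) ∈ ξ},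
            (e, (1 : Fin 2)) ∉ ξ} := by
  intro ξ hξ
  -- `hξ`: the union of the two layers does not join `o` to `b`
  have hπ : ¬ (openGraph ({i | (i, (0 : Fin 2)) ∈ ξ ∨ (i, (1 : Fin 2)) ∈ ξ} :
      Set (Sym2 (Fin n)))).Reachable o b := hξ
  have hsub : ({i | (i, (0 : Fin 2)) ∈ ξ} : Set (Sym2 (Fin n))) ⊆
      {i | (i, (0 : Fin 2)) ∈ ξ ∨ (i, (1 : Fin 2)) ∈ ξ} := fun i hi => Or.inl hi
  by_cases hA : ({i | (i, (0 : Fin 2)) ∈ ξ} : Set (Sym2 (Fin n))) ∈ ⋃ a ∈ A, openConn o a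
  · refine Or.inr ⟨⟨fun hob => hπ ((isUpperSet_openConn o b) hsub hob), ?_⟩, ?_⟩
    · simpa only [mem_iUnion, exists_prop] using hA
    · intro e he h1
      obtain ⟨x, hx, y, hy, rfl, hyb⟩ := (hL _ _ _).1 he
      apply hπ
      -- `o ↔ x` inside the pocket and `y ↔ b` off it, already in layer `0`
      have hox : (openGraph ({i | (i, (0 : Fin 2)) ∈ ξ} : Set (Sym2 (Fin n)))).Reachable o x :=
        reachable_of_pathIn (pathIn_of_mem_openConnIn ((hP _ x).1 hx))
      have hyb' : (openGraph ({i | (i, (0 : Fin 2)) ∈ ξ} : Set (Sym2 (Fin n)))).Reachable y b :=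
        reachable_of_pathIn (pathIn_of_mem_openConnIn hyb)
      have hxy : x ≠ y := fun h => hy (h ▸ hx)
      -- the layer-`1` pair `s(x, y)` is open in the union
      have hadj : (openGraph ({i | (i, (0 : Fin 2)) ∈ ξ ∨ (i, (1 : Fin 2)) ∈ ξ} :
          Set (Sym2 (Fin n)))).Adj x y :=
        (openGraph_adj _ x y).2 ⟨Or.inr h1, hxy⟩
      exact ((hox.mono (openGraph_mono hsub)).trans hadj.reachable).trans
        (hyb'.mono (openGraph_mono hsub))
  · exact Or.inl hA

/-! ### The stub -/

/-- **Sprinkle coupling** (registered stub `stub_sprinkleCoupling` of crux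
stmt-CriticalPhenomena-4574, line `live-seal-vanishing-sprinkle`). If `1 - w' e = (1 - w e)^{1+t}`
(`t > 0`) for every pair, then
`μ_{w'}(o ↮ b) ≤ μ_w(o ↮ A) + ∫ 1{o ↮ b, o ↔ A} (∏_{e ∈ L (P ω) ω} (1 - w e))^t dμ_w(ω)`:
`μ_{w'}` is the law of the union of a `μ_w`-layer and an independent `t`-layer
(`1 - w'' e = (1 - w e)^t`); if the union misses `{o ↔ b}` then either the `w`-layer misses
`{o ↔ A}`, or it is bad and the `t`-layer avoids every live boundary pair of its relay-free pocket,
which, fibrewise over the `w`-layer, has probability `∏ (1 - w e)^t = κ^t`. -/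
theorem stub_sprinkleCoupling (t : ℝ) (ht : 0 < t) (n : ℕ) (w w' : Sym2 (Fin n) → unitInterval)
    (hw : ∀ e, (1 - (w' e : ℝ)) = (1 - (w e : ℝ)) ^ (1 + t))
    (A : Finset (Fin n)) (o b : Fin n) (ho : o ∉ A)
    (P : Set (Sym2 (Fin n)) → Finset (Fin n))
    (hP : ∀ ω v, v ∈ P ω ↔ ω ∈ openConnIn ((↑A : Set (Fin n))ᶜ) o v)
    (L : Finset (Fin n) → Set (Sym2 (Fin n)) → Finset (Sym2 (Fin n)))
    (hL : ∀ T ω e, e ∈ L T ω ↔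
      ∃ x ∈ T, ∃ y ∉ T, e = s(x, y) ∧ ω ∈ openConnIn ((↑T : Set (Fin n))ᶜ) y b) :
    (prodBernoulli w').real (openConn o b)ᶜ ≤
      (prodBernoulli w).real (⋃ a ∈ A, openConn o a)ᶜ +
        ∫ ω, ({ω | ω ∉ openConn o b ∧ ∃ a ∈ A, ω ∈ openConn o a}.indicator
          (fun ω => (∏ e ∈ L (P ω) ω, (1 - (w e : ℝ))) ^ t) ω) ∂(prodBernoulli w) := by
  -- the `t`-layer parameters: `Q (e,0) = w e`, `1 - Q (e,1) = (1 - w e)^t`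
  have h1w : ∀ e, 0 ≤ 1 - (w e : ℝ) := fun e => sub_nonneg.2 (w e).2.2
  have hmem : ∀ e, (1 - (w e : ℝ)) ^ t ∈ unitInterval := fun e =>
    ⟨Real.rpow_nonneg (h1w e) t, Real.rpow_le_one (h1w e) (sub_le_self _ (w e).2.1) ht.le⟩
  obtain ⟨Q, hQ0, hQ1⟩ : ∃ Q : Sym2 (Fin n) × Fin 2 → unitInterval,
      (∀ e, Q (e, 0) = w e) ∧ ∀ e, (1 - (Q (e, 1) : ℝ)) = (1 - (w e : ℝ)) ^ t := by
    refine ⟨fun k => if k.2 = 0 then w k.1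
        else unitInterval.symm ⟨(1 - (w k.1 : ℝ)) ^ t, hmem k.1⟩,
      fun e => if_pos rfl, fun e => ?_⟩
    dsimp only
    rw [if_neg (show (1 : Fin 2) ≠ 0 by decide), unitInterval.coe_symm_eq]
    ring
  have hQw : (fun i => Q (i, 0)) = w := funext hQ0
  -- the superposed parameters `1 - (1 - Q (e,0)) (1 - Q (e,1))` are `w'`
  have hpar : (fun i => unitInterval.symm (unitInterval.symm (Q (i, 0)) *
      unitInterval.symm (Q (i, 1)))) = w' := by
    funext i
    apply Subtype.ext
    rw [coe_symm_symm_mul_symm, hQ1, hQ0]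
    have h := hw i
    rw [Real.rpow_add' (h1w i) (add_pos one_pos ht).ne', Real.rpow_one] at h
    linear_combination h
  -- Step 1: `μ_{w'}(o ↮ b)` is the probability that the union of the layers misses `{o ↔ b}`
  have hstep1 : (prodBernoulli w').real (openConn o b)ᶜ = (prodBernoulli Q).real
      ((fun ξ : Set (Sym2 (Fin n) × Fin 2) =>
          {i | (i, (0 : Fin 2)) ∈ ξ ∨ (i, (1 : Fin 2)) ∈ ξ}) ⁻¹' (openConn o b)ᶜ) := by
    rw [prodBernoulli_real_preimage_superpose Q MeasurableSet.of_discrete, hpar]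
  -- Step 2: the walk lemma and a union bound on the two-layer space
  have hmain : (prodBernoulli Q).real ((fun ξ : Set (Sym2 (Fin n) × Fin 2) =>
        {i | (i, (0 : Fin 2)) ∈ ξ ∨ (i, (1 : Fin 2)) ∈ ξ}) ⁻¹' (openConn o b)ᶜ) ≤
      (prodBernoulli Q).real ((fun ξ : Set (Sym2 (Fin n) × Fin 2) =>
          {i | (i, (0 : Fin 2)) ∈ ξ}) ⁻¹' (⋃ a ∈ A, openConn o a)ᶜ) +
        (prodBernoulli Q).real {ξ : Set (Sym2 (Fin n) × Fin 2) | {i | (i, (0 : Fin 2)) ∈ ξ} ∈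
            {ω | ω ∉ openConn o b ∧ ∃ a ∈ A, ω ∈ openConn o a} ∧
          ∀ e ∈ L (P {i | (i, (0 : Fin 2)) ∈ ξ}) {i | (i, (0 : Fin 2)) ∈ ξ},
            (e, (1 : Fin 2)) ∉ ξ} :=
    (measureReal_mono (sprinkleCoupling_cover A o b P hP L hL)).trans (measureReal_union_le _ _)
  -- Step 3: the layer-`0` term is `μ_w(o ↮ A)` ...
  have hlay : (prodBernoulli Q).real ((fun ξ : Set (Sym2 (Fin n) × Fin 2) =>
        {i | (i, (0 : Fin 2)) ∈ ξ}) ⁻¹' (⋃ a ∈ A, openConn o a)ᶜ) =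
      (prodBernoulli w).real (⋃ a ∈ A, openConn o a)ᶜ := by
    rw [sprinkleCoupling_real_preimage_layer Q MeasurableSet.of_discrete, hQw]
  -- ... and, fibrewise over layer `0`, the seal-avoidance term is `∫_bad κ^t dμ_w`
  have hfib : (prodBernoulli Q).real {ξ : Set (Sym2 (Fin n) × Fin 2) | {i | (i, (0 : Fin 2)) ∈ ξ} ∈
            {ω | ω ∉ openConn o b ∧ ∃ a ∈ A, ω ∈ openConn o a} ∧
          ∀ e ∈ L (P {i | (i, (0 : Fin 2)) ∈ ξ}) {i | (i, (0 : Fin 2)) ∈ ξ},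
            (e, (1 : Fin 2)) ∉ ξ} =
      ∫ ω, ({ω | ω ∉ openConn o b ∧ ∃ a ∈ A, ω ∈ openConn o a}.indicator
          (fun ω => (∏ e ∈ L (P ω) ω, (1 - (w e : ℝ))) ^ t) ω) ∂(prodBernoulli w) := by
    rw [sprinkleCoupling_real_layer_fibre Q _ (fun ω => L (P ω) ω), hQw]
    have hint : ({ω | ω ∉ openConn o b ∧ ∃ a ∈ A, ω ∈ openConn o a}.indicator
          fun ω => ∏ e ∈ L (P ω) ω, (1 - (Q (e, 1) : ℝ))) =
        {ω | ω ∉ openConn o b ∧ ∃ a ∈ A, ω ∈ openConn o a}.indicator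
          (fun ω => (∏ e ∈ L (P ω) ω, (1 - (w e : ℝ))) ^ t) := by
      congr 1
      funext ω
      rw [← Real.finsetProd_rpow _ _ (fun e _ => h1w e)]
      exact Finset.prod_congr rfl fun e _ => hQ1 e
    rw [hint]
  -- (`ho : o ∉ A` belongs to the registered signature; the inequality holds for every `o`)
  have _ := ho
  rw [hstep1, ← hlay, ← hfib]
  exact hmain

end Summit.CriticalPhenomena.PercolationContinuityZ3.Theorems
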